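import Mathlib
import HarnessLib
import Summits.HubbardSuperconductivity.HubbardSuperconductivity.Theorems.KLProgrammeH10TwoPointLimitFrameSectorCount
import Summits.HubbardSuperconductivity.HubbardSuperconductivity.Theorems.KLProgrammeH10TwoPointLimitFrameTorusBridge
import Summits.HubbardSuperconductivity.HubbardSuperconductivity.Theorems.KLProgrammeH10TwoPointLimitFrameFermiPoint

/-!
# Route `KLProgramme` — engine support: the SUPPORT of the engine's sector multipliers on an admissible frame is a small CELL around the
# frame's Fermi point at the sector centre (BGM 2006 (2.69) on the frame's curve; route (L2′) layer (b₃) input)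

Cell `gate-hubbard-kl`, seat p4 (C5a lead), g5; HOME/prover-p4/FRAME-L22-NOTE.md §3″ (b₃).  For a frame `K` of `C²` size `A` with
`2A < Dt_min` (level range `[a, b]`, `B : BandBounds a b`): a torus momentum carrying the anisotropic multiplier `klAnisoFamily … n ω`
(resp. the isotropic `klIsoFamily … n ω`) has its centred representative within
`(klScale e₀ n + s_max·Dt_min·(3 w/4))/(Dt_min − 2A)` of the frame's Fermi point `klFermiPoint μ K θ_{ω}` at the sector centre,
COORDINATEWISE (`w = sectorWidth n`, resp. `sectorWidth (2n)`) — the lineage's `cell_perturbed` fed by the multiplier supports of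
`…FrameTorusBridge` (`support_klAnisoFamily/klIsoFamily`, `exists_abs_lt_of_sectorWeightCirc_ne_zero`).  So the support of the
two-multiplier symbol of (ii) sits in a rotated box of size `O(Λ_n) × O(2^{-n})` around `klFermiPoint`, as the `ℓ²` route's support count needs.
Everything is PROVED; no definitions, no named facts. [cite: BenfattoGiulianiMastropietro2006, §2.7 (2.69)]
-/

noncomputable section

namespace Summit.HubbardSuperconductivity.HubbardSuperconductivity.Theorems.PerturbedFermiCurve

set_option linter.dupNamespace false -- summit = problem name (single-conjunct summit), D-0017

open Classical
open Real Set
open Literature.MathematicalPhysics.QuantumLattice Literature.MathematicalPhysics.QuantumLattice.BandSectorCounting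
open Literature.Probability.LatticeModels
open Summit.HubbardSuperconductivity.HubbardSuperconductivity.Theorems.DispersionFlow
open Summit.HubbardSuperconductivity.HubbardSuperconductivity.Theorems.KLRegimeSplit
open Summit.HubbardSuperconductivity.HubbardSuperconductivity.Theorems.KLProgrammeLegKernels

section Cell

variable {a b : ℝ} (B : BandBounds a b) {K : TrigPolyC4v} {A : ℝ}
  (hA : ∀ p : Momentum, ∀ j ≤ 2, ‖iteratedFDeriv ℝ j (frameShift K) p‖ ≤ A) (hADt : 2 * A < B.Dtmin) {μ : ℝ}
include B hA hADt

/-- **The general cell on a frame**: a momentum of the closed square in the `e_K`-shell `|frameLevel μ K| ≤ η` whose polar angle is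
within `α` of `θ₀` (mod `2π`) is within `(η + s_max Dt_min α)/(Dt_min − 2A)` of `klFermiPoint μ K θ₀`, coordinatewise.
[cite: BenfattoGiulianiMastropietro2006, §2.7 (2.69)] -/
theorem frame_cell {c : Fin 2 → ℝ} {η α θ₀ : ℝ} {m : ℤ} (hc : ∀ i, |c i| ≤ π)
    (hshell : |frameLevel μ K (WithLp.toLp 2 c)| ≤ η) (hlo : a ≤ μ - A - η) (hhi : μ + A + η ≤ b)
    (hang : |Complex.arg (⟨c 0, c 1⟩ : ℂ) + m * (2 * π) - θ₀| ≤ α) (i : Fin 2) :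
    |c i - klFermiPoint μ K θ₀ i| ≤ (η + B.smax * B.Dtmin * α) / (B.Dtmin - 2 * A) := by
  have hη : 0 ≤ η := (abs_nonneg _).trans hshell
  have hlo' : a ≤ μ - A := by linarith
  have hhi' : μ + A ≤ b := by linarith
  have hδ : ∀ k : Fin 2 → ℝ, (∀ i, |k i| ≤ π) → |(fun p : Fin 2 → ℝ => -K.eval p) k| ≤ A := fun k _ => by
    simpa [frameShift_toLp] using abs_frameShift_toLp_le hA k
  have hLip : ∀ k k' : Fin 2 → ℝ, (∀ i, |k i| ≤ π) → (∀ i, |k' i| ≤ π) →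
      |(fun p : Fin 2 → ℝ => -K.eval p) k - (fun p : Fin 2 → ℝ => -K.eval p) k'| ≤ 2 * A * ‖k - k'‖ := fun k k' hk hk' => by
    have h := lipschitz_of_fderiv_le (δ := fun k : Fin 2 → ℝ => frameShift K (WithLp.toLp 2 k))
      (fun k _ => (differentiable_frameShift_toLp K) k) (fun k _ => norm_fderiv_frameShift_toLp_le hA k) hk hk'
    simpa [frameShift_toLp] using h
  have hu := isBandFermiRadius_klFermiRadius B hA hlo' hhi'
  have hshell' : |sqDispersion c + (fun p : Fin 2 → ℝ => -K.eval p) c - μ| ≤ η := by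
    rw [frameLevel_toLp] at hshell; simpa [frameShift_toLp] using hshell
  have h := cell_perturbed B hδ hLip hADt hu hc hshell' hlo hhi hang i
  rw [klFermiPoint_eq]
  simpa [frameShift_toLp_eq_neg_eval] using h

/-- **The support of the ANISOTROPIC multiplier on a frame is a cell around the frame's Fermi point at the sector centre**:
`klAnisoFamily L M β μ K e₀ n ω k ≠ 0 ⇒ |c(k⃗)_i − klFermiPoint μ K θ_{n,ω} i| ≤ (Λ_n + s_max Dt_min (3w_n/4))/(Dt_min − 2A)`,
`Λ_n = klScale e₀ n`, `w_n = sectorWidth n`, `θ_{n,ω} = sectorCenter n ω`. [cite: BenfattoGiulianiMastropietro2006, §2.7 (2.69)] -/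
theorem support_klAnisoFamily_cell (L M : ℕ) {e₀ : ℝ} (he : 0 < e₀) (β : ℝ) (n : ℕ) (hlo : a ≤ μ - A - klScale e₀ n)
    (hhi : μ + A + klScale e₀ n ≤ b) (ω : Fin (sectorCount n)) (k : FreqMomentum L M)
    (h : klAnisoFamily L M β μ K e₀ n ω k ≠ 0) (i : Fin 2) :
    |torusCentredMomentum L k.2 i - klFermiPoint μ K (sectorCenter n ω) i| ≤
      (klScale e₀ n + B.smax * B.Dtmin * (3 * sectorWidth n / 4)) / (B.Dtmin - 2 * A) := by
  obtain ⟨h1, -, h3⟩ := support_klAnisoFamily L M he β μ K n ω k h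
  rw [nambuXiCT_eq_frameLevel] at h1
  rw [momentumAngle_eq_arg] at h3
  obtain ⟨kz, hkz⟩ := exists_abs_lt_of_sectorWeightCirc_ne_zero h3
  have hang : |Complex.arg (⟨torusCentredMomentum L k.2 0, torusCentredMomentum L k.2 1⟩ : ℂ) + (-kz : ℤ) * (2 * π) -
      sectorCenter n ω| ≤ 3 * sectorWidth n / 4 := by
    rw [sectorCenter]
    have e : Complex.arg (⟨torusCentredMomentum L k.2 0, torusCentredMomentum L k.2 1⟩ : ℂ) + ((-kz : ℤ) : ℝ) * (2 * π) -
        (((ω : ℕ) : ℝ) + 1 / 2) * sectorWidth n =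
        Complex.arg (⟨torusCentredMomentum L k.2 0, torusCentredMomentum L k.2 1⟩ : ℂ) -
          ((((ω : ℕ) : ℤ) : ℝ) + 1 / 2) * sectorWidth n - 2 * π * kz := by
      push_cast; ring
    rw [e]
    exact hkz.le
  exact frame_cell B hA hADt (abs_torusCentredMomentum_le_pi L k.2) h1.le hlo hhi hang i

/-- **The same for the ISOTROPIC multiplier** (angular index `2n`): `klIsoFamily L M β μ K e₀ n ω k ≠ 0 ⇒
|c(k⃗)_i − klFermiPoint μ K θ_{2n,ω} i| ≤ (Λ_n + s_max Dt_min (3 w_{2n}/4))/(Dt_min − 2A)`. [cite: BenfattoGiulianiMastropietro2006, §2.7 (2.69)] -/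
theorem support_klIsoFamily_cell (L M : ℕ) {e₀ : ℝ} (he : 0 < e₀) (β : ℝ) (n : ℕ) (hlo : a ≤ μ - A - klScale e₀ n)
    (hhi : μ + A + klScale e₀ n ≤ b) (ω : Fin (sectorCount (2 * n))) (k : FreqMomentum L M)
    (h : klIsoFamily L M β μ K e₀ n ω k ≠ 0) (i : Fin 2) :
    |torusCentredMomentum L k.2 i - klFermiPoint μ K (sectorCenter (2 * n) ω) i| ≤
      (klScale e₀ n + B.smax * B.Dtmin * (3 * sectorWidth (2 * n) / 4)) / (B.Dtmin - 2 * A) := by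
  obtain ⟨h1, -, h3⟩ := support_klIsoFamily L M he β μ K n ω k h
  rw [nambuXiCT_eq_frameLevel] at h1
  rw [momentumAngle_eq_arg] at h3
  obtain ⟨kz, hkz⟩ := exists_abs_lt_of_sectorWeightCirc_ne_zero h3
  have hang : |Complex.arg (⟨torusCentredMomentum L k.2 0, torusCentredMomentum L k.2 1⟩ : ℂ) + (-kz : ℤ) * (2 * π) -
      sectorCenter (2 * n) ω| ≤ 3 * sectorWidth (2 * n) / 4 := by
    rw [sectorCenter]
    have e : Complex.arg (⟨torusCentredMomentum L k.2 0, torusCentredMomentum L k.2 1⟩ : ℂ) + ((-kz : ℤ) : ℝ) * (2 * π) -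
        (((ω : ℕ) : ℝ) + 1 / 2) * sectorWidth (2 * n) =
        Complex.arg (⟨torusCentredMomentum L k.2 0, torusCentredMomentum L k.2 1⟩ : ℂ) -
          ((((ω : ℕ) : ℤ) : ℝ) + 1 / 2) * sectorWidth (2 * n) - 2 * π * kz := by
      push_cast; ring
    rw [e]
    exact hkz.le
  exact frame_cell B hA hADt (abs_torusCentredMomentum_le_pi L k.2) h1.le hlo hhi hang i

end Cell

end Summit.HubbardSuperconductivity.HubbardSuperconductivity.Theorems.PerturbedFermiCurve

end
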